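import Mathlib
import Summits.Ventures.PercRepro2.ZMean
import Summits.Ventures.PercRepro2.ZMeanBound
import Summits.Ventures.PercRepro2.PocketConn
import Summits.Ventures.PercRepro2.PocketLaw
import Summits.Ventures.PercRepro2.PocketRowPD

/-!
# The T rows of `X̂` in a root-only pocket

Steps (ii)/(iii) of the mean-field bookkeeping of the root-only-pocket theorem.  On a cluster
`W ∋ a₂` of `a₃` the root `a₂` is isolated in the residual graph `G ∖ W`, so Lemma 1 applies to
`G ∖ W` unconditionally: residual connections between vertices outside the pocket are outside
connections in `G₁ ∖ (W ∖ P)` (`conn_residual_iff_of_mem`), hence `termT(W) = outTermT(W ∖ P)`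
depends on `W` only through its outside part (`termT_pocket`).  Summing fiberwise over
`W₂ = W ∖ P`, the fibre `{C(a₃) = W : W ∖ P = W₂, a₂ ∈ W, a₁ ∉ W}` is the event
`Q ∩ {a₂ ↔ a₃} ∩ {C₁(a₂) = W₂}` (`clusterEvent_inter_TRowEvent`), which factors by the pocket law
into `π₂ · P(Q₁, C₁(a₂) = W₂)`: the T rows sum to `π₂ · Y_T` (`sum_t_rows`).
-/

namespace Summit.Ventures.PercRepro2

namespace PocketConn

variable {V : Type*} {E : Type*}

/-- A vertex connected outside the pocket to a vertex outside the pocket is outside the pocket. -/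
lemma not_mem_of_conn_restrict_compl {ends : E → Sym2 V} {ω : Config E} {P : Set V}
    [DecidablePred (· ∈ (touches ends P)ᶜ)] {x v : V} (hx : x ∉ P)
    (h : Conn ends (restrict (touches ends P)ᶜ ω) x v) : v ∉ P := by
  have key : v ∈ {z | z ∉ P} := by
    refine mem_of_conn_of_closed (ends := ends) (ω := restrict (touches ends P)ᶜ ω) ?_ hx h
    rintro z hz w hzw
    obtain ⟨_, e, he, hends⟩ := openGraph_adj.1 hzw
    simp only [Set.mem_setOf_eq] at hz ⊢
    intro hwP
    exact (restrict_eq_true_iff.1 he).2 (mem_touches_of_ends hends (Or.inr hwP))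
  exact key

/-- A vertex of `W` is isolated once the edges touching `W` are closed. -/
lemma not_conn_of_isolated {ends : E → Sym2 V} {ω : Config E} {W : Set V}
    [DecidablePred (· ∈ (touches ends W)ᶜ)] {x y : V} (hy : y ∈ W) (hxy : x ≠ y) :
    ¬ Conn ends (restrict (touches ends W)ᶜ ω) x y := by
  intro h
  have key : y ∈ {z | z ≠ y} := by
    refine mem_of_conn_of_closed (ends := ends) (ω := restrict (touches ends W)ᶜ ω) ?_ hxy h
    rintro z hz w hzw
    obtain ⟨_, e, he, hends⟩ := openGraph_adj.1 hzw
    simp only [Set.mem_setOf_eq] at hz ⊢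
    rintro rfl
    exact (restrict_eq_true_iff.1 he).2 (mem_touches_of_ends hends (Or.inr hy))
  exact key rfl

/-- The pocket condition is symmetric in the two roots. -/
lemma IsPocket.symm {ends : E → Sym2 V} {P : Set V} {a₁ a₂ : V} (hP : IsPocket ends P a₁ a₂) :
    IsPocket ends P a₂ a₁ := fun e x y h hx =>
  (hP e x y h hx).elim Or.inl (fun h' => h'.elim (fun h₁ => Or.inr (Or.inr h₁))
    (fun h₂ => Or.inr (Or.inl h₂)))

section Finite

variable [Fintype V] [DecidableEq V]

variable {ends : E → Sym2 V} {P : Finset V} {a₁ a₂ a₃ : V}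

/-- Closing the edges touching `W` and then those touching `P` is closing those touching `P`
and then those touching `W ∖ P`. -/
lemma restrict_compl_comm_sdiff (W : Finset V) (ω : Config E) :
    restrict (touches ends (↑P : Set V))ᶜ (restrict (touches ends (↑W : Set V))ᶜ ω) =
      restrict (touches ends (↑(W \ P) : Set V))ᶜ
        (restrict (touches ends (↑P : Set V))ᶜ ω) := by
  funext e
  simp only [restrict]
  by_cases hP' : e ∈ touches ends (↑P : Set V)
  · simp [hP']
  · have hiff : e ∈ touches ends (↑W : Set V) ↔ e ∈ touches ends (↑(W \ P) : Set V) := by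
      constructor
      · rintro ⟨x, hx, y, hxy⟩
        refine ⟨x, ?_, y, hxy⟩
        rw [Finset.coe_sdiff]
        exact ⟨hx, fun hxP => hP' ⟨x, hxP, y, hxy⟩⟩
      · rintro ⟨x, hx, y, hxy⟩
        rw [Finset.coe_sdiff] at hx
        exact ⟨x, hx.1, y, hxy⟩
    simp [hP', hiff]

/-- **Lemma 1 in the residual graph `G ∖ W` with `a₂ ∈ W`** (`a₂` isolated, so `Q` holds in the
residual graph): for `x, v ∉ P`, residual connections are outside connections in
`G₁ ∖ (W ∖ P)`. -/
theorem conn_residual_iff_of_mem (hP : IsPocket ends (↑P : Set V) a₁ a₂) (h12 : a₁ ≠ a₂)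
    {W : Finset V} (h2W : a₂ ∈ W) {ω : Config E} {x v : V} (hx : x ∉ P) (hv : v ∉ P) :
    Conn ends (restrict (touches ends (↑W : Set V))ᶜ ω) x v ↔
      Conn ends (restrict (touches ends (↑(W \ P) : Set V))ᶜ
        (restrict (touches ends (↑P : Set V))ᶜ ω)) x v := by
  rw [conn_iff_conn_restrict hP (not_conn_of_isolated (by simpa using h2W) h12)
    (by simpa using hx) (by simpa using hv), restrict_compl_comm_sdiff W ω]

/-- The T-row event with outside root cluster `W₂`: `Q`, `a₂ ↔ a₃`, and `C₁(a₂) = W₂`. -/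
def TRowEvent (ends : E → Sym2 V) (P : Finset V) (a₁ a₂ a₃ : V) (W₂ : Finset V) :
    Set (Config E) :=
  {ω | ¬ Conn ends ω a₁ a₂ ∧ Conn ends ω a₂ a₃ ∧
    cluster ends (restrict (touches ends (↑P : Set V))ᶜ ω) a₂ = (↑W₂ : Set V)}

/-- The outside cluster of a root is disjoint from the pocket. -/
lemma cluster_restrict_compl_sdiff (h2 : a₂ ∉ P) (ω : Config E) :
    cluster ends (restrict (touches ends (↑P : Set V))ᶜ ω) a₂ \ (↑P : Set V) =
      cluster ends (restrict (touches ends (↑P : Set V))ᶜ ω) a₂ := by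
  ext z
  simp only [Set.mem_sdiff, and_iff_left_iff_imp, mem_cluster]
  intro hz
  exact not_mem_of_conn_restrict_compl (by simpa using h2) hz

/-- On `Q ∩ {a₂ ↔ a₃}`, the outside part of the cluster of `a₃` is the outside cluster of `a₂`. -/
lemma cluster_sdiff_eq (hP : IsPocket ends (↑P : Set V) a₁ a₂) (h1 : a₁ ∉ P) (h2 : a₂ ∉ P)
    {ω : Config E} (hQ : ¬ Conn ends ω a₁ a₂) (h23 : Conn ends ω a₂ a₃) :
    cluster ends ω a₃ \ (↑P : Set V) =
      cluster ends (restrict (touches ends (↑P : Set V))ᶜ ω) a₂ := by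
  rw [← cluster_eq_of_conn h23, cluster_root_eq hP hQ (by simpa using h1) (by simpa using h2)
    (Or.inr rfl), Set.union_sdiff_distrib, cluster_restrict_compl_sdiff h2]
  have : {v | v ∈ (↑P : Set V) ∧ Conn ends (restrict (touches ends (↑P : Set V)) ω) v a₂} \
      (↑P : Set V) = ∅ := by
    ext z
    simp only [Set.mem_sdiff, Set.mem_setOf_eq, Set.mem_empty_iff_false, iff_false, not_and,
      not_not]
    exact fun h => h.1
  rw [this, Set.union_empty]

/-- The cluster event `{C(a₃) = W}` meets the T-row event with outside cluster `W₂` in all of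
`{C(a₃) = W}` when `a₂ ∈ W`, `a₁ ∉ W` and `W ∖ P = W₂`, and in nothing otherwise. -/
lemma clusterEvent_inter_TRowEvent (hP : IsPocket ends (↑P : Set V) a₁ a₂) (h1 : a₁ ∉ P)
    (h2 : a₂ ∉ P) (W W₂ : Finset V) :
    clusterEvent ends a₃ (↑W : Set V) ∩ TRowEvent ends P a₁ a₂ a₃ W₂ =
      if a₂ ∈ W ∧ a₁ ∉ W ∧ W \ P = W₂ then clusterEvent ends a₃ (↑W : Set V) else ∅ := by
  ext ω
  split_ifs with hc
  · simp only [Set.mem_inter_iff, mem_clusterEvent, and_iff_left_iff_imp]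
    intro hW
    have h32 : Conn ends ω a₃ a₂ := by
      have : a₂ ∈ cluster ends ω a₃ := by
        rw [hW]
        exact Finset.mem_coe.2 hc.1
      exact this
    have hQ : ¬ Conn ends ω a₁ a₂ := by
      intro h
      have : a₁ ∈ cluster ends ω a₃ := conn_trans h32 (conn_symm h)
      rw [hW] at this
      exact hc.2.1 (Finset.mem_coe.1 this)
    refine ⟨hQ, conn_symm h32, ?_⟩
    rw [← cluster_sdiff_eq hP h1 h2 hQ (conn_symm h32), hW, ← Finset.coe_sdiff, hc.2.2]
  · simp only [Set.mem_inter_iff, mem_clusterEvent, Set.mem_empty_iff_false, iff_false, not_and]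
    intro hW hT
    apply hc
    obtain ⟨hQ, h23, hcl⟩ := hT
    refine ⟨?_, ?_, ?_⟩
    · have : a₂ ∈ cluster ends ω a₃ := conn_symm h23
      rw [hW] at this
      exact Finset.mem_coe.1 this
    · intro h1W
      have : a₁ ∈ cluster ends ω a₃ := by
        rw [hW]
        exact Finset.mem_coe.2 h1W
      exact hQ (conn_trans (conn_symm this) (conn_symm h23))
    · apply Finset.coe_injective
      rw [Finset.coe_sdiff, ← hW, cluster_sdiff_eq hP h1 h2 hQ h23, hcl]

section Prob

variable [Fintype E] [DecidableEq E] {R : Type*} [CommRing R]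

/-- `P_{G₁∖W₂}(x ↔ v)`, `0` for a vertex `v` of `W₂`: the outside residual connection
probability. -/
noncomputable def outDelConnProb (p : E → R) (ends : E → Sym2 V) (P W₂ : Finset V) (x v : V) :
    R :=
  if v ∈ W₂ then 0 else
    prob p {ω | Conn ends (restrict (touches ends (↑W₂ : Set V))ᶜ
      (restrict (touches ends (↑P : Set V))ᶜ ω)) x v}

/-- The T-type term of the outside graph with root cluster `W₂` removed. -/
noncomputable def outTermT (p : E → R) (ends : E → Sym2 V) (P W₂ : Finset V) (o x b : V) : R :=
  outDelConnProb p ends P W₂ x o * (if b ∈ W₂ then 1 else -outDelConnProb p ends P W₂ x b)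

/-- The fibre identity: `P(T-row event with W₂) = Σ_{W : W ∖ P = W₂} 1[a₂ ∈ W, a₁ ∉ W] P(C(a₃) = W)`. -/
theorem prob_TRowEvent_eq_sum (p : E → R) (hP : IsPocket ends (↑P : Set V) a₁ a₂) (h1 : a₁ ∉ P)
    (h2 : a₂ ∉ P) (W₂ : Finset V) :
    prob p (TRowEvent ends P a₁ a₂ a₃ W₂) =
      ∑ W ∈ Finset.univ.filter (fun W : Finset V => W \ P = W₂),
        (if a₂ ∈ W ∧ a₁ ∉ W then prob p (clusterEvent ends a₃ (↑W : Set V)) else 0) := by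
  rw [prob_eq_sum_clusterEvent p ends a₃, Finset.sum_filter]
  refine Finset.sum_congr rfl (fun W _ => ?_)
  rw [clusterEvent_inter_TRowEvent hP h1 h2 W W₂]
  by_cases hc : a₂ ∈ W ∧ a₁ ∉ W ∧ W \ P = W₂
  · rw [if_pos hc, if_pos hc.2.2, if_pos ⟨hc.1, hc.2.1⟩]
  · rw [if_neg hc, prob_empty]
    by_cases hW : W \ P = W₂
    · rw [if_pos hW, if_neg (fun h => hc ⟨h.1, h.2, hW⟩)]
    · rw [if_neg hW]

/-- The T-row event factors by the pocket law: `π₂ · P(Q₁, C₁(a₂) = W₂)`. -/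
theorem prob_TRowEvent_eq_mul (p : E → R) (hP : IsPocket ends (↑P : Set V) a₁ a₂) (h1 : a₁ ∉ P)
    (h2 : a₂ ∉ P) (h3 : a₃ ∈ P) (W₂ : Finset V) :
    prob p (TRowEvent ends P a₁ a₂ a₃ W₂) =
      prob p {ω | ¬ Conn ends (restrict (touches ends (↑P : Set V)) ω) a₁ a₂ ∧
          Conn ends (restrict (touches ends (↑P : Set V)) ω) a₃ a₂} *
        prob p {ω | ¬ Conn ends (restrict (touches ends (↑P : Set V))ᶜ ω) a₁ a₂ ∧
          cluster ends (restrict (touches ends (↑P : Set V))ᶜ ω) a₂ = (↑W₂ : Set V)} := by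
  have h := prob_Q_root_mul p hP (by simpa using h1) (by simpa using h2) (Or.inr rfl)
    (by simpa using h3) (fun σ => cluster ends σ a₂ = (↑W₂ : Set V))
  have e : (connEvent ends a₁ a₂)ᶜ ∩ connEvent ends a₂ a₃ ∩
      {ω | cluster ends (restrict (touches ends (↑P : Set V))ᶜ ω) a₂ = (↑W₂ : Set V)} =
      TRowEvent ends P a₁ a₂ a₃ W₂ := by
    ext ω
    simp only [Set.mem_inter_iff, Set.mem_compl_iff, mem_connEvent, Set.mem_setOf_eq, TRowEvent,
      and_assoc]
  rw [e] at h
  exact h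

end Prob

section Field

variable [Fintype E] [DecidableEq E] {R : Type*} [Field R]

/-- The residual connection probability on a cluster containing `a₂` depends only on the
outside part of the cluster. -/
theorem delConnProb_pocket (p : E → R) (hP : IsPocket ends (↑P : Set V) a₁ a₂) (h12 : a₁ ≠ a₂)
    {W : Finset V} (h2W : a₂ ∈ W) {x v : V} (hx : x ∉ P) (hv : v ∉ P) :
    delConnProb p ends W x v = outDelConnProb p ends P (W \ P) x v := by
  have hvW : v ∈ W ↔ v ∈ W \ P := by simp [Finset.mem_sdiff, hv]
  simp only [delConnProb, outDelConnProb]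
  by_cases h : v ∈ W
  · rw [if_pos h, if_pos (hvW.1 h)]
  · rw [if_neg h, if_neg (fun h' => h (hvW.2 h'))]
    congr 1
    ext ω
    simp only [mem_connDelEvent, Set.mem_setOf_eq]
    exact conn_residual_iff_of_mem hP h12 h2W hx hv

/-- **The T-type term on a cluster containing `a₂`** depends on the cluster only through its
outside part `W ∖ P`. -/
theorem termT_pocket (p : E → R) (hP : IsPocket ends (↑P : Set V) a₁ a₂) (h12 : a₁ ≠ a₂)
    (h1 : a₁ ∉ P) {W : Finset V} (h2W : a₂ ∈ W) {o b : V} (ho : o ∉ P) (hb : b ∉ P) :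
    termT p ends W o a₁ b = outTermT p ends P (W \ P) o a₁ b := by
  have hbW : b ∈ W ↔ b ∈ W \ P := by simp [Finset.mem_sdiff, hb]
  simp only [termT, outTermT, delConnProb_pocket p hP h12 h2W h1 ho,
    delConnProb_pocket p hP h12 h2W h1 hb]
  by_cases h : b ∈ W
  · rw [if_pos h, if_pos (hbW.1 h)]
  · rw [if_neg h, if_neg (fun h' => h (hbW.2 h'))]

/-- **The T rows of `X̂` in a root-only pocket**: summed over the clusters `W ∋ a₂`, `a₁ ∉ W`,
`Σ_W P(C(a₃) = W) · termT(W) = π₂ · Y_T` with `π₂ = P(Q_P, a₃ ↔_P a₂)` and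
`Y_T = Σ_{W₂} P(Q₁, C₁(a₂) = W₂) · outTermT(W₂)`. -/
theorem sum_t_rows (p : E → R) (hP : IsPocket ends (↑P : Set V) a₁ a₂) (h12 : a₁ ≠ a₂)
    (h1 : a₁ ∉ P) (h2 : a₂ ∉ P) {o b : V} (ho : o ∉ P) (hb : b ∉ P) (h3 : a₃ ∈ P) :
    ∑ W : Finset V, (if a₂ ∈ W ∧ a₁ ∉ W then
        prob p (clusterEvent ends a₃ (↑W : Set V)) * termT p ends W o a₁ b else 0) =
      prob p {ω | ¬ Conn ends (restrict (touches ends (↑P : Set V)) ω) a₁ a₂ ∧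
          Conn ends (restrict (touches ends (↑P : Set V)) ω) a₃ a₂} *
        ∑ W₂ : Finset V, prob p {ω | ¬ Conn ends (restrict (touches ends (↑P : Set V))ᶜ ω) a₁ a₂ ∧
          cluster ends (restrict (touches ends (↑P : Set V))ᶜ ω) a₂ = (↑W₂ : Set V)} *
          outTermT p ends P W₂ o a₁ b := by
  have hterm : ∀ W : Finset V, (if a₂ ∈ W ∧ a₁ ∉ W then
      prob p (clusterEvent ends a₃ (↑W : Set V)) * termT p ends W o a₁ b else 0) =
      (if a₂ ∈ W ∧ a₁ ∉ W then prob p (clusterEvent ends a₃ (↑W : Set V)) else 0) *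
        outTermT p ends P (W \ P) o a₁ b := by
    intro W
    by_cases h : a₂ ∈ W ∧ a₁ ∉ W
    · rw [if_pos h, if_pos h, termT_pocket p hP h12 h1 h.1 ho hb]
    · rw [if_neg h, if_neg h, zero_mul]
  rw [Finset.sum_congr rfl (fun W _ => hterm W),
    ← Finset.sum_fiberwise Finset.univ (fun W : Finset V => W \ P), Finset.mul_sum]
  refine Finset.sum_congr rfl (fun W₂ _ => ?_)
  rw [Finset.sum_congr rfl (fun W hW => by rw [(Finset.mem_filter.1 hW).2]), ← Finset.sum_mul,
    ← prob_TRowEvent_eq_sum p hP h1 h2 W₂, prob_TRowEvent_eq_mul p hP h1 h2 h3 W₂, mul_assoc]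

/-- **The T′ rows of `X̂`** (mirror of `sum_t_rows`: clusters `W ∋ a₁`, `a₂ ∉ W`). -/
theorem sum_t'_rows (p : E → R) (hP : IsPocket ends (↑P : Set V) a₁ a₂) (h12 : a₁ ≠ a₂)
    (h1 : a₁ ∉ P) (h2 : a₂ ∉ P) {o b : V} (ho : o ∉ P) (hb : b ∉ P) (h3 : a₃ ∈ P) :
    ∑ W : Finset V, (if a₁ ∈ W ∧ a₂ ∉ W then
        prob p (clusterEvent ends a₃ (↑W : Set V)) * termT p ends W o a₂ b else 0) =
      prob p {ω | ¬ Conn ends (restrict (touches ends (↑P : Set V)) ω) a₂ a₁ ∧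
          Conn ends (restrict (touches ends (↑P : Set V)) ω) a₃ a₁} *
        ∑ W₂ : Finset V, prob p {ω | ¬ Conn ends (restrict (touches ends (↑P : Set V))ᶜ ω) a₂ a₁ ∧
          cluster ends (restrict (touches ends (↑P : Set V))ᶜ ω) a₁ = (↑W₂ : Set V)} *
          outTermT p ends P W₂ o a₂ b :=
  sum_t_rows p hP.symm h12.symm h2 h1 ho hb h3

/-- The three row families of `X̂`: every cluster `W` of `a₃` is a PD row (no root), a T row
(`a₂ ∈ W`, `a₁ ∉ W`), a T′ row (`a₁ ∈ W`, `a₂ ∉ W`) or contains both roots (term `0`). -/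
lemma termW_split (p : E → R) (W : Finset V) (o b : V) :
    prob p (clusterEvent ends a₃ (↑W : Set V)) *
        (if a₁ ∈ W then (if a₂ ∈ W then 0 else termT p ends W o a₂ b)
          else (if a₂ ∈ W then termT p ends W o a₁ b else termPD p ends W o a₁ a₂ b)) =
      (if a₁ ∉ W ∧ a₂ ∉ W then
          prob p (clusterEvent ends a₃ (↑W : Set V)) * termPD p ends W o a₁ a₂ b else 0) +
        (if a₂ ∈ W ∧ a₁ ∉ W then
          prob p (clusterEvent ends a₃ (↑W : Set V)) * termT p ends W o a₁ b else 0) +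
        (if a₁ ∈ W ∧ a₂ ∉ W then
          prob p (clusterEvent ends a₃ (↑W : Set V)) * termT p ends W o a₂ b else 0) := by
  by_cases h1 : a₁ ∈ W <;> by_cases h2 : a₂ ∈ W <;> simp [h1, h2]

/-- **`X̂` in a root-only pocket** (Lemma 3 of the root-only-pocket theorem):
`X̂ = π₀ · (A_L¹B_H¹ + A_H¹B_L¹)/Z₁ + π₂ · Y_T + π₁ · Y_T′`. -/
theorem Xhat_pocket (p : E → R) (hP : IsPocket ends (↑P : Set V) a₁ a₂) (h12 : a₁ ≠ a₂)
    (h1 : a₁ ∉ P) (h2 : a₂ ∉ P) {o b : V} (ho : o ∉ P) (hb : b ∉ P) (h3 : a₃ ∈ P) :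
    Xhat p ends o a₁ a₂ a₃ b =
      prob p (PDPocket ends P a₁ a₂ a₃) *
          ((outMass p ends P a₁ a₂ a₁ o * outMass p ends P a₁ a₂ a₂ b +
              outMass p ends P a₁ a₂ a₂ o * outMass p ends P a₁ a₂ a₁ b) /
            prob p (QOutside ends (↑P : Set V) a₁ a₂)) +
        prob p {ω | ¬ Conn ends (restrict (touches ends (↑P : Set V)) ω) a₁ a₂ ∧
            Conn ends (restrict (touches ends (↑P : Set V)) ω) a₃ a₂} *
          ∑ W₂ : Finset V,
            prob p {ω | ¬ Conn ends (restrict (touches ends (↑P : Set V))ᶜ ω) a₁ a₂ ∧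
              cluster ends (restrict (touches ends (↑P : Set V))ᶜ ω) a₂ = (↑W₂ : Set V)} *
              outTermT p ends P W₂ o a₁ b +
        prob p {ω | ¬ Conn ends (restrict (touches ends (↑P : Set V)) ω) a₂ a₁ ∧
            Conn ends (restrict (touches ends (↑P : Set V)) ω) a₃ a₁} *
          ∑ W₂ : Finset V,
            prob p {ω | ¬ Conn ends (restrict (touches ends (↑P : Set V))ᶜ ω) a₂ a₁ ∧
              cluster ends (restrict (touches ends (↑P : Set V))ᶜ ω) a₁ = (↑W₂ : Set V)} *
              outTermT p ends P W₂ o a₂ b := by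
  rw [Xhat, Finset.sum_congr rfl (fun W _ => termW_split p W o b), Finset.sum_add_distrib,
    Finset.sum_add_distrib, sum_pd_rows p hP h1 h2 ho hb h3, sum_t_rows p hP h12 h1 h2 ho hb h3,
    sum_t'_rows p hP h12 h1 h2 ho hb h3]

end Field

end Finite

end PocketConn

end Summit.Ventures.PercRepro2
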